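import Literature.AlgebraicGeometry.Resolution.BaseTreeFiniteKonig
import HarnessLib

/-!
# The base tree of an ideal: Zariski's count `N' ≤ N − 1` through the first quadratic transforms
# (Zariski–Samuel II, Appendix 5; bookkeeping for Stacks Project Lemma 54.4.1 = Tag 0AHH)

Topic: `Literature/AlgebraicGeometry/Resolution`. Theorem-only file (sorry-free, no definitions, no
named facts), a brick toward the discharge of the named fact F-75c
`Stacks0BIC_embeddedResolutionCurvesInSurfaces_locus` (`EmbeddedResolutionCurvesInSurfaces.lean`): its
Cartier step (Stacks Lemma 54.15.5 = Tag 0BIB) principalizes an ideal sheaf on a regular surface by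
blowing up closed points (Lemma 54.4.1 = Tag 0AHH). The tree proves the FINITENESS of the base tree of an
ideal `J` of a two-dimensional regular local ring `R` of `K` — the set `idealBaseTree R J` of iterated
quadratic transforms of `R` in which `J` does not become principal (`BaseTreeFinite.lean`,
`finite_idealBaseTree_of_isRegularLocalRing` of `BaseTreeFiniteKonig.lean`; Zariski–Samuel II, App. 5)
— and Zariski's count through the first transforms for the base tree of a VECTOR
(`sum_baseCount_add_one_le`, `QuadraticTransformsTree.lean`). This file records the same count for
IDEALS, the termination measure of the principalization by point blow-ups:

* `extIdeal_self`, `self_mem_idealBaseTree_iff`, `idealBaseTree_eq_empty_of_isPrincipal`,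
  `idealBaseTree_subset_of_isQuadraticTransform` — bookkeeping;
* `baseTree_eq_idealBaseTree` — for generators `w` of `J` (elements of `R ⊆ K`), the base tree of the
  vector `w` is the base tree of the ideal `J` (`definedOn_iff_isPrincipal_extIdeal`);
* `sum_ncard_idealBaseTree_add_one_le` — **for a local ring `R` of `K` with `𝔪_R` finitely generated
  and not principal, a finitely generated non-principal ideal `J ≠ 0` with finite base tree, and a finite
  set `F` of quadratic transforms of `R`:
  `∑_{R₁ ∈ F} #idealBaseTree R₁ (J R₁) + 1 ≤ #idealBaseTree R J`** (the base trees of distinct first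
  transforms are disjoint subsets of the base tree of `R`, which also contains `R`).

AI-written over the tree's bricks; weaker than expert review. Not a statement of [Hironaka2017].

## References
* O. Zariski, P. Samuel, *Commutative Algebra* II (1960), Appendix 5. [ZariskiSamuel1960]
* The Stacks Project, Tag 0AHH (Lemma 54.4.1). [StacksProject]
* O. Piltant, J. Algebra 374 (2013), Lemma 5.6 (proof). [Piltant2013]
-/

noncomputable section

namespace Literature.AlgebraicGeometry.Resolution

universe u

open IsLocalRing

variable {K : Type u} [Field K]

/-! ## Bookkeeping on `extIdeal` and `idealBaseTree` -/

/-- `extIdeal J R = J` (the extension of an ideal to its own ring). [cite: ZariskiSamuel1960, Appendix 5] -/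
theorem extIdeal_self {R : Subring K} (J : Ideal R) : extIdeal J R = J := by
  rw [extIdeal_eq_map J le_rfl]
  have h : Subring.inclusion (le_refl R) = RingHom.id R := RingHom.ext fun _ => rfl
  rw [h, Ideal.map_id]

/-- Membership in the base tree of an ideal. [cite: ZariskiSamuel1960, Appendix 5] -/
theorem mem_idealBaseTree_iff {R S : Subring K} {J : Ideal R} :
    S ∈ idealBaseTree R J ↔
      Relation.ReflTransGen IsQuadraticTransform R S ∧ ¬ (extIdeal J S).IsPrincipal :=
  Iff.rfl

/-- `R` lies in the base tree of `J` iff `J` is not principal. [cite: ZariskiSamuel1960, Appendix 5] -/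
theorem self_mem_idealBaseTree_iff {R : Subring K} {J : Ideal R} :
    R ∈ idealBaseTree R J ↔ ¬ J.IsPrincipal := by
  rw [mem_idealBaseTree_iff, extIdeal_self]
  exact ⟨fun h => h.2, fun h => ⟨Relation.ReflTransGen.refl, h⟩⟩

/-- The base tree of a principal ideal is empty (principality persists to every ring above).
[cite: ZariskiSamuel1960, Appendix 5] -/
theorem idealBaseTree_eq_empty_of_isPrincipal {R : Subring K} {J : Ideal R} (hJ : J.IsPrincipal) :
    idealBaseTree R J = ∅ := by
  ext S
  simp only [mem_idealBaseTree_iff, Set.mem_empty_iff_false, iff_false, not_and, not_not]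
  intro hS
  exact isPrincipal_extIdeal_of_le (J := J) le_rfl (subringDominates_of_reflTransGen hS).1
    (by rw [extIdeal_self]; exact hJ)

/-- A member of a base tree which is non-empty at the root has at least one element; more precisely
`#idealBaseTree R J ≥ 1` when `J` is not principal and the tree is finite.
[cite: ZariskiSamuel1960, Appendix 5] -/
theorem one_le_ncard_idealBaseTree {R : Subring K} {J : Ideal R} (hJ : ¬ J.IsPrincipal)
    (hfin : (idealBaseTree R J).Finite) : 1 ≤ (idealBaseTree R J).ncard := by
  rw [Nat.one_le_iff_ne_zero, Ne, Set.ncard_eq_zero hfin]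
  intro he
  have h := self_mem_idealBaseTree_iff.mpr hJ
  rw [he] at h
  exact h

/-- **The base tree of a quadratic transform `R₁` of `R` (for the extended ideal `J R₁`) lies in the
base tree of `R`, off the root.** (`𝔪_R` not principal.) [cite: ZariskiSamuel1960, Appendix 5] -/
theorem idealBaseTree_subset_of_isQuadraticTransform {R R₁ : Subring K} {J : Ideal R}
    (h₁ : IsQuadraticTransform R R₁)
    (hm : ∀ (hR : IsLocalRing R) (z : R), @maximalIdeal R _ hR ≠ Ideal.span {z}) :
    idealBaseTree R₁ (extIdeal J R₁) ⊆ idealBaseTree R J \ {R} := by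
  intro S hS
  obtain ⟨hRS, hnp⟩ := hS
  have hle₁ : R ≤ R₁ := h₁.dominates.1
  have hle : R₁ ≤ S := (subringDominates_of_reflTransGen hRS).1
  have hext : extIdeal (extIdeal J R₁) S = extIdeal J S := by
    rw [extIdeal_eq_map (extIdeal J R₁) hle, map_extIdeal J hle₁ hle]
  refine ⟨⟨Relation.ReflTransGen.head h₁ hRS, by rwa [hext] at hnp⟩, fun hSR => ?_⟩
  rw [Set.mem_singleton_iff] at hSR
  subst hSR
  exact not_reflTransGen_of_isQuadraticTransform h₁ hm hRS

/-! ## Vector base tree = ideal base tree for generators -/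

/-- **For generators `w` of `J` lying in `R`, the base tree of the vector `w` is the base tree of the
ideal `J`.** [cite: ZariskiSamuel1960, Appendix 5] -/
theorem baseTree_eq_idealBaseTree {R : Subring K} [IsLocalRing R] {n : ℕ} (w : Fin (n + 1) → K)
    (hw : ∃ i, w i ≠ 0) (hwR : ∀ l, w l ∈ R) {J : Ideal R}
    (hJ : J = Ideal.span (Set.range fun l => (⟨w l, hwR l⟩ : R))) :
    baseTree R w = idealBaseTree R J := by
  have hc : ∀ l, ((1 : R) : K) * w l ∈ R := fun l => by rw [OneMemClass.coe_one, one_mul]; exact hwR l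
  have hJc : J = coordIdeal w 1 hc := by
    rw [hJ, coordIdeal]
    congr 1
    ext z
    simp only [Set.mem_range]
    constructor
    · rintro ⟨l, rfl⟩; exact ⟨l, Subtype.ext (by simp)⟩
    · rintro ⟨l, rfl⟩; exact ⟨l, Subtype.ext (by simp)⟩
  ext S
  rw [mem_baseTree_iff, mem_idealBaseTree_iff]
  refine and_congr_right fun hRS => not_congr ?_
  haveI : IsLocalRing S := isLocalRing_of_reflTransGen hRS
  rw [hJc]
  exact definedOn_iff_isPrincipal_extIdeal w hw 1 (by simp) hc (subringDominates_of_reflTransGen hRS).1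

/-- Generators of a non-zero finitely generated ideal of `R ⊆ K`, as a vector of elements of `K`
indexed by `Fin (n + 1)`, not all zero. [folklore] -/
private theorem exists_fin_generators_of_fg {R : Subring K} {J : Ideal R} (hfg : J.FG) (hJ0 : J ≠ ⊥) :
    ∃ (n : ℕ) (w : Fin (n + 1) → K) (hwR : ∀ l, w l ∈ R), (∃ i, w i ≠ 0) ∧
      J = Ideal.span (Set.range fun l => (⟨w l, hwR l⟩ : R)) := by
  obtain ⟨m, g, hg⟩ := Submodule.fg_iff_exists_fin_generating_family.mp hfg
  -- `m ≠ 0` since `J ≠ ⊥`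
  obtain ⟨n, rfl⟩ : ∃ n, m = n + 1 := by
    rcases m with _ | n
    · exfalso
      apply hJ0
      rw [← hg]
      simp
    · exact ⟨n, rfl⟩
  refine ⟨n, fun l => (g l : K), fun l => (g l).2, ?_, ?_⟩
  · by_contra h
    push Not at h
    apply hJ0
    rw [← hg, Submodule.span_eq_bot]
    rintro _ ⟨l, rfl⟩
    exact Subtype.ext (h l)
  · rw [← hg]

/-! ## The count -/

/-- **Zariski's count for ideals** (Zariski–Samuel II, App. 5; Piltant 2013, proof of Lemma 5.6): for a
local ring `R` of `K` with `𝔪_R` finitely generated and not principal, a finitely generated,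
non-principal ideal `J ≠ 0` of `R` with finite base tree, and a finite set `F` of quadratic transforms
of `R`, `∑_{R₁ ∈ F} #idealBaseTree R₁ (J R₁) + 1 ≤ #idealBaseTree R J`.
[cite: ZariskiSamuel1960, Appendix 5] [cite: Piltant2013, Lemma 5.6 (proof)] -/
theorem sum_ncard_idealBaseTree_add_one_le {R : Subring K} [IsLocalRing R]
    (hfg : (maximalIdeal R).FG) (hm : ∀ z : R, maximalIdeal R ≠ Ideal.span {z})
    {J : Ideal R} (hJfg : J.FG) (hJ0 : J ≠ ⊥) (hJ : ¬ J.IsPrincipal)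
    (hfin : (idealBaseTree R J).Finite) (F : Finset (Subring K))
    (hF : ∀ R₁ ∈ F, IsQuadraticTransform R R₁) :
    ∑ R₁ ∈ F, (idealBaseTree R₁ (extIdeal J R₁)).ncard + 1 ≤ (idealBaseTree R J).ncard := by
  obtain ⟨n, w, hwR, hw, hJw⟩ := exists_fin_generators_of_fg hJfg hJ0
  have hR : baseTree R w = idealBaseTree R J := baseTree_eq_idealBaseTree w hw hwR hJw
  have hR₁ : ∀ R₁ ∈ F, baseTree R₁ w = idealBaseTree R₁ (extIdeal J R₁) := by
    intro R₁ h₁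
    haveI : IsLocalRing R₁ := (hF R₁ h₁).isLocalRing
    have hle : R ≤ R₁ := (hF R₁ h₁).dominates.1
    refine baseTree_eq_idealBaseTree w hw (fun l => hle (hwR l)) ?_
    rw [hJw, extIdeal_eq_map _ hle, Ideal.map_span, ← Set.range_comp]
    rfl
  have hdef : ¬ DefinedOn w R := fun h => by
    have he := baseTree_eq_empty_of_definedOn h
    rw [hR] at he
    have hmem := self_mem_idealBaseTree_iff.mpr hJ
    rw [he] at hmem
    exact hmem
  have h := sum_baseCount_add_one_le hfg hm hdef (by rw [hR]; exact hfin) F hF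
  rw [baseCount, hR] at h
  have hsum : ∑ R₁ ∈ F, baseCount R₁ w = ∑ R₁ ∈ F, (idealBaseTree R₁ (extIdeal J R₁)).ncard :=
    Finset.sum_congr rfl fun R₁ h₁ => by rw [baseCount, hR₁ R₁ h₁]
  rwa [hsum] at h

end Literature.AlgebraicGeometry.Resolution

end
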